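import Mathlib
import HarnessLib
import Summits.HubbardSuperconductivity.HubbardSuperconductivity.Theorems.KLProgrammeKLRegimeWickFlowBilinear
import Summits.HubbardSuperconductivity.HubbardSuperconductivity.Theorems.KLProgrammeKLRegimeWickPairKernelDefs
import Summits.HubbardSuperconductivity.HubbardSuperconductivity.Theorems.AposterioriCapRgSeededBrokenRegimeBoseFermiPinnedScaleFlow
import Literature.MathematicalPhysics.QuantumLattice.GrassmannPolchinskiEquation
import Literature.MathematicalPhysics.QuantumLattice.GrassmannCumulantSeries

/-!
# Route `KLProgramme` — crux K3, ENGINE child gen 5 (stmt-HubbardSuperconductivity-19918 `KLRegimeEngineV14`), stub `stub_engine_step_values`,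
# conjunct (E2-v9) at `1 ≤ n`: the SCALE FLOW of the Wick-smeared action at REAL cutoff — `klws_hasDerivAt_kernel_wickActionR`

Cell gate-hubbard-kl, seat hubbard-kl-k3c1-p1 (g6), technique «composed-map remainder propagation».  Step 1 of the CALL ORDER of the
continuous (E2) organisation (HOME/hubbard-kl-k3c1-p1/KLTC-INDEX.md, evidence #30 on 19918; E2-CONTINUOUS-ROUTE.md, evidence #24)
as a theorem about the tree's MODEL objects.  The Wick-smeared action of the KL programme is defined on the scale grid
(`klWickAction … n = e^{Δ_{D_n}}𝒱_n`, `D_n = C^K_{≤Λ_n}`); its carrier at a REAL cutoff `Λ` is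
`𝒲_Λ := gaussConv ℂ (hubbardCovBelowCT … Λ) (hubbardEffectiveActionCT … Λ)` (no new definition is introduced: the statements are
about this expression; `klws_wickActionR_klScale` identifies it with `klWickAction … n` at `Λ = Λ_n` by `rfl`).

* §1 (generic finite Grassmann algebra, any entrywise differentiable covariance curve `C_r`, `D_r = C∞ − C_r`, even `V` with
  `[V]_∅ = 0`, `Z_t ≠ 0`): **`klws_hasCoeffDerivAt_wickCarrier`** — the Wick carrier `e^{Δ_{D_r}}𝒱_r` of the normalised effective
  action `𝒱_r = effAction (C r) V` is coefficientwise differentiable with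
  `∂_t(e^{Δ_{D_t}}𝒱_t) = e^{Δ_{D_t}}(−½(δ𝒱_t/δψ, Ċ δ𝒱_t/δψ)_Γ − κ_t·1)`, `κ_t = [Δ_Ċ𝒱_t − ½(δ𝒱_t/δψ, Ċ δ𝒱_t/δψ)]_∅`
  (`GrassmannPolchinskiEquation.hasCoeffDerivAt_effAction_flow` + `GrassmannWickOrderedRGE.hasCoeffDerivAt_gaussConv_sub_of_add`: the
  linear term drops out); hence **c-FREE kernel flow in every positive degree** `klws_hasDerivAt_kernel_wickCarrier`:
  `∂_t kernel_m(e^{Δ_{D_t}}𝒱_t) = −½·kernel_m(e^{Δ_{D_t}}(δ𝒱_t/δψ, Ċ δ𝒱_t/δψ))` (the logarithm of the partition function in Salmhofer's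
  `𝒢 = c − 𝒱` never enters), and its star-product form `klws_hasDerivAt_kernel_wickCarrier_star`
  (`= −½·kernel_m(Σ_{X,Y} Ċ_{XY}•(∂_X𝒲_t) ⋆_{D_t} (∂_Y𝒲_t))`, by `klwf_gaussConv_derivPairing_eq_sum_wickStar`, p500937); persistence of
  `Z ≠ 0` near `t`.
* §2 (the model, seed `h = 0`, frame `K`, any `β U μ`): along the scale, with `Ċ_Λ` ANY entrywise `Λ`-derivative of `hubbardCovAboveCT … Λ`
  (for `Λ ≠ 0` the tree supplies it: `hasDerivAt_hubbardCovAboveCT_scale`, AposterioriCapRg) and `Z^K_Λ ≠ 0`: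
  **`klws_hasDerivAt_kernel_wickActionR`** / `_star` (kernels of positive degree), `klws_hasDerivAt_vertexFn_wickActionR` (vertex
  functions), **`klws_hasDerivAt_pairKernelR`** / `_star` (the frequency-resolved pair kernel — p1 g9's `klWickPairKernel` label tuple — at
  real cutoff), `klws_hasDerivAt_apply_wickActionR` (weak form through every linear functional), `klws_hasDerivAt_softCov_scale`
  (`∂_Λ D_Λ = −Ċ_Λ`), `klws_effPartitionFnCT_ne_zero_nhds`, the grid identifications `klws_wickActionR_klScale` /
  `klws_pairKernelR_klScale` (`rfl`) and the semigroup along the slice `klws_effectiveActionCT_eq_effAction_slice`.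

What it gives the (E2-v9) prover: the entrywise `HasDerivAt` input `hΓ` of `kltc_riccati_duhamel_weighted` (p500198) /
`kltc_wickStep_of_flow` (p501252) for `Γ(Λ) :=` the Wick pair kernel at real cutoff, with the derivative ALREADY in the two-vertex
star-product form the channel reading (p1 g9 `…WickBubbleColourings*/…ChannelPP/PH`, line pair `(Ċ_Λ, D_Λ)`) consumes.  Exact calculus over
landed lemmas; no analytic bound and nothing about superconductivity is asserted.  0 kit.
-/

noncomputable section

namespace Summit.HubbardSuperconductivity.HubbardSuperconductivity.Theorems.KLRegimeWick

set_option linter.dupNamespace false -- summit = problem name (single-conjunct summit), D-0017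

open Finset Literature.MathematicalPhysics.QuantumLattice GrassmannAlgebra
open scoped Topology

/-! ## §1 Generic: the Wick carrier of the normalised effective action along a covariance curve -/

section Generic

variable {𝕂 : Type*} [NontriviallyNormedField 𝕂] {𝕜 : Type*} [RCLike 𝕜] [NormedAlgebra 𝕂 𝕜]
variable {Γ : Type*} [LinearOrder Γ] [Fintype Γ]

/-- **The Wick carrier of the normalised effective action is coefficientwise differentiable**, with only the bilinear term (and a
constant) surviving: for `𝒱_r = effAction (C r) V`, `D_r = C∞ − C_r`,
`∂_t(e^{Δ_{D_t}}𝒱_t) = e^{Δ_{D_t}}(−½(δ𝒱_t/δψ, Ċ δ𝒱_t/δψ)_Γ − κ_t·1)`, `κ_t = [Δ_Ċ𝒱_t − ½(δ𝒱_t/δψ, Ċ δ𝒱_t/δψ)_Γ]_∅`. -/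
theorem klws_hasCoeffDerivAt_wickCarrier {C : 𝕂 → Matrix Γ Γ 𝕜} {C' : Matrix Γ Γ 𝕜} {t : 𝕂}
    (Cinf : Matrix Γ Γ 𝕜) (hC : ∀ X Y, HasDerivAt (fun r => C r X Y) (C' X Y) t) {V : GrassmannAlgebra 𝕜 Γ}
    (hV0 : constPart 𝕜 V = 0) (hVe : V ∈ evenOdd 𝕜 0) (hZt : effPartitionFn 𝕜 (C t) V ≠ 0) :
    HasCoeffDerivAt (fun r => gaussConv 𝕜 (Cinf - C r) (effAction 𝕜 (C r) V))
      (gaussConv 𝕜 (Cinf - C t)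
        (-((2 : 𝕜)⁻¹ • grassmannDerivPairing 𝕜 C' (effAction 𝕜 (C t) V) (effAction 𝕜 (C t) V)) -
          constPart 𝕜 (grassmannLaplacian 𝕜 C' (effAction 𝕜 (C t) V) -
              (2 : 𝕜)⁻¹ • grassmannDerivPairing 𝕜 C' (effAction 𝕜 (C t) V) (effAction 𝕜 (C t) V)) • 1)) t := by
  refine hasCoeffDerivAt_gaussConv_sub_of_add Cinf hC
    ((hasCoeffDerivAt_effAction_flow hC hV0 hVe hZt).1.congr_deriv ?_)
  abel

omit [LinearOrder Γ] in
/-- The smearing fixes the scalars: `kernel_m(e^{Δ_D} 1) = 0` for `0 < m`. -/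
theorem klws_kernel_gaussConv_one_eq_zero (D : Matrix Γ Γ 𝕜) {m : ℕ} (hm : 0 < m) (X : Fin m → Γ) :
    kernel 𝕜 (gaussConv 𝕜 D (1 : GrassmannAlgebra 𝕜 Γ)) m X = 0 := by
  have h1 : (1 : GrassmannAlgebra 𝕜 Γ) = algebraMap 𝕜 (GrassmannAlgebra 𝕜 Γ) 1 := (map_one _).symm
  rw [h1, gaussConv_algebraMap]
  exact kernel_algebraMap_eq_zero (𝕜 := 𝕜) (Γ := Γ) (c := 1) hm X

/-- **The c-free kernel flow of the Wick carrier in every positive degree**: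
`∂_t kernel_m(e^{Δ_{D_t}}𝒱_t) = −½·kernel_m(e^{Δ_{D_t}}(δ𝒱_t/δψ, Ċ δ𝒱_t/δψ)_Γ)` (`0 < m`). -/
theorem klws_hasDerivAt_kernel_wickCarrier {C : 𝕂 → Matrix Γ Γ 𝕜} {C' : Matrix Γ Γ 𝕜} {t : 𝕂}
    (Cinf : Matrix Γ Γ 𝕜) (hC : ∀ X Y, HasDerivAt (fun r => C r X Y) (C' X Y) t) {V : GrassmannAlgebra 𝕜 Γ}
    (hV0 : constPart 𝕜 V = 0) (hVe : V ∈ evenOdd 𝕜 0) (hZt : effPartitionFn 𝕜 (C t) V ≠ 0) {m : ℕ} (hm : 0 < m)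
    (X : Fin m → Γ) :
    HasDerivAt (fun r => kernel 𝕜 (gaussConv 𝕜 (Cinf - C r) (effAction 𝕜 (C r) V)) m X)
      (-((2 : 𝕜)⁻¹ * kernel 𝕜 (gaussConv 𝕜 (Cinf - C t)
        (grassmannDerivPairing 𝕜 C' (effAction 𝕜 (C t) V) (effAction 𝕜 (C t) V))) m X)) t := by
  have h := (klws_hasCoeffDerivAt_wickCarrier Cinf hC hV0 hVe hZt).apply (kernelLM 𝕜 Γ m X)
  simp only [map_sub, map_neg, map_smul, kernelLM_apply, klws_kernel_gaussConv_one_eq_zero _ hm, smul_eq_mul, mul_zero,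
    sub_zero] at h
  exact h

/-- **Star-product form**: `∂_t kernel_m(𝒲_t) = −½·kernel_m(Σ_{X,Y} Ċ_{XY}•(∂_X𝒲_t) ⋆_{D_t} (∂_Y𝒲_t))`, `𝒲_t = e^{Δ_{D_t}}𝒱_t` — the
source is a sum of two-vertex terms with one `Ċ` line and `D_t` lines between the vertices. -/
theorem klws_hasDerivAt_kernel_wickCarrier_star {C : 𝕂 → Matrix Γ Γ 𝕜} {C' : Matrix Γ Γ 𝕜} {t : 𝕂}
    (Cinf : Matrix Γ Γ 𝕜) (hC : ∀ X Y, HasDerivAt (fun r => C r X Y) (C' X Y) t) {V : GrassmannAlgebra 𝕜 Γ}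
    (hV0 : constPart 𝕜 V = 0) (hVe : V ∈ evenOdd 𝕜 0) (hZt : effPartitionFn 𝕜 (C t) V ≠ 0) {m : ℕ} (hm : 0 < m)
    (X : Fin m → Γ) :
    HasDerivAt (fun r => kernel 𝕜 (gaussConv 𝕜 (Cinf - C r) (effAction 𝕜 (C r) V)) m X)
      (-((2 : 𝕜)⁻¹ * kernel 𝕜 (∑ Y, ∑ Y', C' Y Y' •
        wickStar 𝕜 (Cinf - C t)
          (grassmannDeriv 𝕜 Y (gaussConv 𝕜 (Cinf - C t) (effAction 𝕜 (C t) V)))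
          (grassmannDeriv 𝕜 Y' (gaussConv 𝕜 (Cinf - C t) (effAction 𝕜 (C t) V)))) m X)) t := by
  have h := klws_hasDerivAt_kernel_wickCarrier Cinf hC hV0 hVe hZt hm X
  rwa [klwf_gaussConv_derivPairing_eq_sum_wickStar] at h

/-- Along a differentiable covariance curve the partition function stays non-zero near a point where it is non-zero. -/
theorem klws_effPartitionFn_ne_zero_nhds {C : 𝕂 → Matrix Γ Γ 𝕜} {C' : Matrix Γ Γ 𝕜} {t : 𝕂}
    (hC : ∀ X Y, HasDerivAt (fun r => C r X Y) (C' X Y) t) {V : GrassmannAlgebra 𝕜 Γ} (hZt : effPartitionFn 𝕜 (C t) V ≠ 0) :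
    ∀ᶠ r in 𝓝 t, effPartitionFn 𝕜 (C r) V ≠ 0 :=
  (hasDerivAt_effPartitionFn_flow hC V).continuousAt.eventually_ne hZt

end Generic

/-! ## §2 The model: the Wick-smeared action of the KL programme at real cutoff, differentiated in the scale -/

section Model

open Literature.Probability.LatticeModels
open Summit.HubbardSuperconductivity.HubbardSuperconductivity.Theorems.KLProgrammeLegKernels
open Summit.HubbardSuperconductivity.HubbardSuperconductivity.Theorems.KLRegimeSplit

variable (L M : ℕ) [NeZero L] (β U μ : ℝ) (K : TrigPolyC4v)

/-- **On the scale grid the real-cutoff Wick carrier IS `klWickAction`**: `e^{Δ_{C^K_{≤Λ_n}}}𝒢^K_{Λ_n} = 𝒲_n`. -/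
theorem klws_wickActionR_klScale (n : ℕ) :
    gaussConv ℂ (hubbardCovBelowCT L M β μ 0 K (klScale klE0 n)) (hubbardEffectiveActionCT L M β U μ 0 K (klScale klE0 n)) =
      klWickAction L M β U μ K n := rfl

/-- … and the real-cutoff pair kernel at `Λ = Λ_n` is p1's `klWickPairKernel … n`. -/
theorem klws_pairKernelR_klScale (n : ℕ) (Q : TorusSite 2 L) (x y : TorusSite 2 L × MatsubaraIdx M) :
    vertexFn L M β (gaussConv ℂ (hubbardCovBelowCT L M β μ 0 K (klScale klE0 n))
        (hubbardEffectiveActionCT L M β U μ 0 K (klScale klE0 n))) 4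
      ![(((y.2, y.1), 0), 0), (((y.2.rev, Q - y.1), 1), 0), (((x.2.rev, Q - x.1), 1), 1), (((x.2, x.1), 0), 1)] =
      klWickPairKernel L M β U μ K n Q x y := rfl

omit [NeZero L] in
/-- **The soft covariance moves opposite to the hard one**: `∂_Λ C^K_{≤Λ}(X,Y) = −Ċ_Λ(X,Y)`. -/
theorem klws_hasDerivAt_softCov_scale {Λ : ℝ} {C' : Matrix (HubbardFieldIdx L M) (HubbardFieldIdx L M) ℂ}
    (hC : ∀ X Y, HasDerivAt (fun Λ' : ℝ => hubbardCovAboveCT L M β μ 0 K Λ' X Y) (C' X Y) Λ) (X Y : HubbardFieldIdx L M) :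
    HasDerivAt (fun Λ' : ℝ => hubbardCovBelowCT L M β μ 0 K Λ' X Y) (-C' X Y) Λ := by
  simpa only [hubbardCovBelowCT, Matrix.neg_apply] using hasDerivAt_sub_cov (hubbardCovarianceCT L M β μ 0 K) hC X Y

omit [NeZero L] in
/-- For `Λ ≠ 0` the tree's entrywise scale derivative of `C^K_{>Λ}` (smooth Salmhofer cutoff) is available as `Ċ_Λ`. -/
theorem klws_hasDerivAt_hardCov_scale {Λ : ℝ} (hΛ : Λ ≠ 0) (X Y : HubbardFieldIdx L M) :
    HasDerivAt (fun Λ' : ℝ => hubbardCovAboveCT L M β μ 0 K Λ' X Y)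
      ((Matrix.of fun X Y : HubbardFieldIdx L M => deriv (fun Λ' : ℝ => hubbardCovAboveCT L M β μ 0 K Λ' X Y) Λ) X Y) Λ :=
  AposterioriCapRgSeededBrokenRegimeBoseFermiPinned.hasDerivAt_hubbardCovAboveCT_scale L M β μ 0 K Λ X Y hΛ

/-- **The partition function of the slice does not vanish near a scale where it does not vanish.** -/
theorem klws_effPartitionFnCT_ne_zero_nhds {Λ : ℝ} {C' : Matrix (HubbardFieldIdx L M) (HubbardFieldIdx L M) ℂ}
    (hC : ∀ X Y, HasDerivAt (fun Λ' : ℝ => hubbardCovAboveCT L M β μ 0 K Λ' X Y) (C' X Y) Λ)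
    (hZ : hubbardEffPartitionFnCT L M β U μ 0 K Λ ≠ 0) :
    ∀ᶠ Λ' in 𝓝 Λ, hubbardEffPartitionFnCT L M β U μ 0 K Λ' ≠ 0 := by
  letI : LinearOrder (HubbardFieldIdx L M) := LinearOrder.lift' (Fintype.equivFin _) (Fintype.equivFin _).injective
  exact klws_effPartitionFn_ne_zero_nhds (𝕂 := ℝ) hC hZ

/-- **The semigroup along the slice**: `𝒢^K_Λ = effAction (C^K_{(Λ,Λ']}) 𝒢^K_{Λ'}` whenever `Z^K_{Λ'} ≠ 0` — the real-cutoff action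
interpolates the step `𝒱_{n−1} ↦ 𝒱_n` (`Λ' = Λ_{n−1}`, `Λ ∈ [Λ_n, Λ_{n−1}]`). -/
theorem klws_effectiveActionCT_eq_effAction_slice {Λ' : ℝ} (Λ : ℝ) (hZ : hubbardEffPartitionFnCT L M β U μ 0 K Λ' ≠ 0) :
    hubbardEffectiveActionCT L M β U μ 0 K Λ =
      effAction ℂ (hubbardCovSliceCT L M β μ 0 K Λ Λ') (hubbardEffectiveActionCT L M β U μ 0 K Λ') :=
  hubbardEffectiveActionCT_semigroup L M β U μ 0 K Λ hZ

/-- **The scale flow of the Wick-smeared action, weakly**: for every linear functional `φ`,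
`∂_Λ φ(𝒲_Λ) = φ(e^{Δ_{D_Λ}}(−½(δ𝒱_Λ/δψ, Ċ_Λ δ𝒱_Λ/δψ)_Γ − κ_Λ·1))`. -/
theorem klws_hasDerivAt_apply_wickActionR {Λ : ℝ} {C' : Matrix (HubbardFieldIdx L M) (HubbardFieldIdx L M) ℂ}
    (hC : ∀ X Y, HasDerivAt (fun Λ' : ℝ => hubbardCovAboveCT L M β μ 0 K Λ' X Y) (C' X Y) Λ)
    (hZ : hubbardEffPartitionFnCT L M β U μ 0 K Λ ≠ 0) (φ : HubbardGrassmann L M →ₗ[ℂ] ℂ) :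
    HasDerivAt (fun Λ' : ℝ => φ (gaussConv ℂ (hubbardCovBelowCT L M β μ 0 K Λ') (hubbardEffectiveActionCT L M β U μ 0 K Λ')))
      (φ (gaussConv ℂ (hubbardCovBelowCT L M β μ 0 K Λ)
        (-((2 : ℂ)⁻¹ • grassmannDerivPairing ℂ C' (hubbardEffectiveActionCT L M β U μ 0 K Λ)
              (hubbardEffectiveActionCT L M β U μ 0 K Λ)) -
          constPart ℂ (grassmannLaplacian ℂ C' (hubbardEffectiveActionCT L M β U μ 0 K Λ) -
              (2 : ℂ)⁻¹ • grassmannDerivPairing ℂ C' (hubbardEffectiveActionCT L M β U μ 0 K Λ)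
                (hubbardEffectiveActionCT L M β U μ 0 K Λ)) • 1))) Λ := by
  letI : LinearOrder (HubbardFieldIdx L M) := LinearOrder.lift' (Fintype.equivFin _) (Fintype.equivFin _).injective
  exact (klws_hasCoeffDerivAt_wickCarrier (𝕂 := ℝ) (hubbardCovarianceCT L M β μ 0 K) hC
    (constPart_hubbardInteractionCT L M β U K) (AposterioriCapRgSeededBrokenRegimeBoseFermiPinned.hubbardInteractionCT_mem_evenOdd_zero L M β U K) hZ).apply φ

/-- **The scale flow of the Wick-smeared kernels** (positive degree, c-free):
`∂_Λ kernel_m(𝒲_Λ) = −½·kernel_m(e^{Δ_{D_Λ}}(δ𝒱_Λ/δψ, Ċ_Λ δ𝒱_Λ/δψ)_Γ)`. -/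
theorem klws_hasDerivAt_kernel_wickActionR {Λ : ℝ} {C' : Matrix (HubbardFieldIdx L M) (HubbardFieldIdx L M) ℂ}
    (hC : ∀ X Y, HasDerivAt (fun Λ' : ℝ => hubbardCovAboveCT L M β μ 0 K Λ' X Y) (C' X Y) Λ)
    (hZ : hubbardEffPartitionFnCT L M β U μ 0 K Λ ≠ 0) {m : ℕ} (hm : 0 < m) (X : Fin m → HubbardFieldIdx L M) :
    HasDerivAt (fun Λ' : ℝ => kernel ℂ (gaussConv ℂ (hubbardCovBelowCT L M β μ 0 K Λ')
        (hubbardEffectiveActionCT L M β U μ 0 K Λ')) m X)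
      (-((2 : ℂ)⁻¹ * kernel ℂ (gaussConv ℂ (hubbardCovBelowCT L M β μ 0 K Λ)
        (grassmannDerivPairing ℂ C' (hubbardEffectiveActionCT L M β U μ 0 K Λ) (hubbardEffectiveActionCT L M β U μ 0 K Λ))) m X)) Λ := by
  letI : LinearOrder (HubbardFieldIdx L M) := LinearOrder.lift' (Fintype.equivFin _) (Fintype.equivFin _).injective
  exact klws_hasDerivAt_kernel_wickCarrier (𝕂 := ℝ) (hubbardCovarianceCT L M β μ 0 K) hC
    (constPart_hubbardInteractionCT L M β U K) (AposterioriCapRgSeededBrokenRegimeBoseFermiPinned.hubbardInteractionCT_mem_evenOdd_zero L M β U K) hZ hm X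

/-- **Star-product form of the kernel flow**: `∂_Λ kernel_m(𝒲_Λ) = −½·kernel_m(Σ_{X,Y} Ċ_Λ(X,Y)•(∂_X𝒲_Λ) ⋆_{D_Λ} (∂_Y𝒲_Λ))`. -/
theorem klws_hasDerivAt_kernel_wickActionR_star {Λ : ℝ} {C' : Matrix (HubbardFieldIdx L M) (HubbardFieldIdx L M) ℂ}
    (hC : ∀ X Y, HasDerivAt (fun Λ' : ℝ => hubbardCovAboveCT L M β μ 0 K Λ' X Y) (C' X Y) Λ)
    (hZ : hubbardEffPartitionFnCT L M β U μ 0 K Λ ≠ 0) {m : ℕ} (hm : 0 < m) (X : Fin m → HubbardFieldIdx L M) :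
    HasDerivAt (fun Λ' : ℝ => kernel ℂ (gaussConv ℂ (hubbardCovBelowCT L M β μ 0 K Λ')
        (hubbardEffectiveActionCT L M β U μ 0 K Λ')) m X)
      (-((2 : ℂ)⁻¹ * kernel ℂ (∑ Y, ∑ Y', C' Y Y' •
        wickStar ℂ (hubbardCovBelowCT L M β μ 0 K Λ)
          (grassmannDeriv ℂ Y (gaussConv ℂ (hubbardCovBelowCT L M β μ 0 K Λ) (hubbardEffectiveActionCT L M β U μ 0 K Λ)))
          (grassmannDeriv ℂ Y' (gaussConv ℂ (hubbardCovBelowCT L M β μ 0 K Λ) (hubbardEffectiveActionCT L M β U μ 0 K Λ))))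
        m X)) Λ := by
  letI : LinearOrder (HubbardFieldIdx L M) := LinearOrder.lift' (Fintype.equivFin _) (Fintype.equivFin _).injective
  exact klws_hasDerivAt_kernel_wickCarrier_star (𝕂 := ℝ) (hubbardCovarianceCT L M β μ 0 K) hC
    (constPart_hubbardInteractionCT L M β U K) (AposterioriCapRgSeededBrokenRegimeBoseFermiPinned.hubbardInteractionCT_mem_evenOdd_zero L M β U K) hZ hm X

/-- **The scale flow of the Wick vertex functions** (positive degree): `∂_Λ 𝒱_m(𝒲_Λ)(X) = −½·𝒱_m(e^{Δ_{D_Λ}}(δ𝒱_Λ/δψ, Ċ_Λ δ𝒱_Λ/δψ))(X)`. -/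
theorem klws_hasDerivAt_vertexFn_wickActionR {Λ : ℝ} {C' : Matrix (HubbardFieldIdx L M) (HubbardFieldIdx L M) ℂ}
    (hC : ∀ X Y, HasDerivAt (fun Λ' : ℝ => hubbardCovAboveCT L M β μ 0 K Λ' X Y) (C' X Y) Λ)
    (hZ : hubbardEffPartitionFnCT L M β U μ 0 K Λ ≠ 0) {m : ℕ} (hm : 0 < m) (X : Fin m → HubbardFieldIdx L M) :
    HasDerivAt (fun Λ' : ℝ => vertexFn L M β (gaussConv ℂ (hubbardCovBelowCT L M β μ 0 K Λ')
        (hubbardEffectiveActionCT L M β U μ 0 K Λ')) m X)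
      (-((2 : ℂ)⁻¹ * vertexFn L M β (gaussConv ℂ (hubbardCovBelowCT L M β μ 0 K Λ)
        (grassmannDerivPairing ℂ C' (hubbardEffectiveActionCT L M β U μ 0 K Λ) (hubbardEffectiveActionCT L M β U μ 0 K Λ))) m X)) Λ := by
  have h := (klws_hasDerivAt_kernel_wickActionR L M β U μ K hC hZ hm X).const_mul
    ((((m.factorial : ℝ) * (β * (L : ℝ) ^ 2) ^ (m - 1) : ℝ) : ℂ))
  simp only [vertexFn_def]
  refine h.congr_deriv ?_
  ring

/-- **The scale flow of the frequency-resolved Wick pair kernel at real cutoff** (the label tuple of `klWickPairKernel … Q x y`):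
`∂_Λ K_Λ(Q)(x,y) = −½·𝒱₄(e^{Δ_{D_Λ}}(δ𝒱_Λ/δψ, Ċ_Λ δ𝒱_Λ/δψ))(pair labels)` — the `hΓ` input of `kltc_riccati_duhamel_weighted` /
`kltc_wickStep_of_flow` before reparametrisation. -/
theorem klws_hasDerivAt_pairKernelR {Λ : ℝ} {C' : Matrix (HubbardFieldIdx L M) (HubbardFieldIdx L M) ℂ}
    (hC : ∀ X Y, HasDerivAt (fun Λ' : ℝ => hubbardCovAboveCT L M β μ 0 K Λ' X Y) (C' X Y) Λ)
    (hZ : hubbardEffPartitionFnCT L M β U μ 0 K Λ ≠ 0) (Q : TorusSite 2 L) (x y : TorusSite 2 L × MatsubaraIdx M) :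
    HasDerivAt (fun Λ' : ℝ => vertexFn L M β (gaussConv ℂ (hubbardCovBelowCT L M β μ 0 K Λ')
        (hubbardEffectiveActionCT L M β U μ 0 K Λ')) 4
        ![(((y.2, y.1), 0), 0), (((y.2.rev, Q - y.1), 1), 0), (((x.2.rev, Q - x.1), 1), 1), (((x.2, x.1), 0), 1)])
      (-((2 : ℂ)⁻¹ * vertexFn L M β (gaussConv ℂ (hubbardCovBelowCT L M β μ 0 K Λ)
        (grassmannDerivPairing ℂ C' (hubbardEffectiveActionCT L M β U μ 0 K Λ) (hubbardEffectiveActionCT L M β U μ 0 K Λ))) 4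
        ![(((y.2, y.1), 0), 0), (((y.2.rev, Q - y.1), 1), 0), (((x.2.rev, Q - x.1), 1), 1), (((x.2, x.1), 0), 1)])) Λ :=
  klws_hasDerivAt_vertexFn_wickActionR L M β U μ K hC hZ (by norm_num) _

/-- **Star-product form of the pair-kernel flow**: the source is `−½ Σ_{X,Y} Ċ_Λ(X,Y)·𝒱₄((∂_X𝒲_Λ) ⋆_{D_Λ} (∂_Y𝒲_Λ))(pair labels)` — two
copies of `𝒲_Λ` joined by one `Ċ_Λ` line and any number of `D_Λ` lines, read at the pair labels (the object of the three-channel reading). -/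
theorem klws_hasDerivAt_pairKernelR_star {Λ : ℝ} {C' : Matrix (HubbardFieldIdx L M) (HubbardFieldIdx L M) ℂ}
    (hC : ∀ X Y, HasDerivAt (fun Λ' : ℝ => hubbardCovAboveCT L M β μ 0 K Λ' X Y) (C' X Y) Λ)
    (hZ : hubbardEffPartitionFnCT L M β U μ 0 K Λ ≠ 0) (Q : TorusSite 2 L) (x y : TorusSite 2 L × MatsubaraIdx M) :
    HasDerivAt (fun Λ' : ℝ => vertexFn L M β (gaussConv ℂ (hubbardCovBelowCT L M β μ 0 K Λ')
        (hubbardEffectiveActionCT L M β U μ 0 K Λ')) 4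
        ![(((y.2, y.1), 0), 0), (((y.2.rev, Q - y.1), 1), 0), (((x.2.rev, Q - x.1), 1), 1), (((x.2, x.1), 0), 1)])
      (-((2 : ℂ)⁻¹ * vertexFn L M β (∑ Y, ∑ Y', C' Y Y' •
        wickStar ℂ (hubbardCovBelowCT L M β μ 0 K Λ)
          (grassmannDeriv ℂ Y (gaussConv ℂ (hubbardCovBelowCT L M β μ 0 K Λ) (hubbardEffectiveActionCT L M β U μ 0 K Λ)))
          (grassmannDeriv ℂ Y' (gaussConv ℂ (hubbardCovBelowCT L M β μ 0 K Λ) (hubbardEffectiveActionCT L M β U μ 0 K Λ)))) 4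
        ![(((y.2, y.1), 0), 0), (((y.2.rev, Q - y.1), 1), 0), (((x.2.rev, Q - x.1), 1), 1), (((x.2, x.1), 0), 1)])) Λ := by
  have h := klws_hasDerivAt_pairKernelR L M β U μ K hC hZ Q x y
  rwa [klwf_gaussConv_derivPairing_eq_sum_wickStar] at h

end Model

end Summit.HubbardSuperconductivity.HubbardSuperconductivity.Theorems.KLRegimeWick

end
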